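import Summits.KontsevichZagierPeriods.KontsevichZagierPeriods.Theses.FurushoPentagon
import Summits.KontsevichZagierPeriods.KontsevichZagierPeriods.Theorems.FurushoPentagonStuffleInKZ
import Summits.KontsevichZagierPeriods.KontsevichZagierPeriods.Theorems.FurushoPentagonHoffmanRelationInKZ
import Summits.KontsevichZagierPeriods.KontsevichZagierPeriods.Theorems.PentagonInKZ.Negative.KernelImplies
import Summits.KontsevichZagierPeriods.KontsevichZagierPeriods.Theorems.ReducedPeriodRing.Negative.RingForms
import Literature.NumberTheory.Transcendental.KZKernelConjectureForms

/-!
# `KernelModuloPeriodConjecture` (stmt-KontsevichZagierPeriods-15058): negative side — anatomy and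
# load-bearing analysis

Cdisprove unit of the crux `KernelModuloPeriodConjecture` (route `FurushoPentagon`, rev 20, the
route's DECLARED REMAINDER): `MzvPeriodConjecture → PentagonInKZ → ReducedPeriodRing → SectorToKernel`.
PROVED here (all `sorry`-free; nothing asserts a route item positively):

* §1 ANATOMY. The inner antecedents of `SectorToKernel` are tree theorems, so the crux is
  `Z → P → R → KernelForm` (`iff_kernelForm`) and `KernelForm` is the summit (`withEvalHyp_iff_summit`),
  hence `iff_summit : crux ↔ (Z → P → R → KontsevichZagierPeriods)`, `iff_or : crux ↔ (Z → summit) ∨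
  ¬P ∨ ¬R`, and `not_iff_summit : ¬crux ↔ Z ∧ P ∧ R ∧ ¬summit` — every refutation of the crux is at
  once a PROOF of the period conjecture for `MT(ℤ)` on the Hoffman multiple zeta values
  (`hoffman_injective_of_not` records the injectivity shadow) and a DISPROOF of Conjecture 1
  (`not_summit_of_not`). No unconditional refutation can therefore be filed.
* §2 LOAD-BEARING ANALYSIS. Dropping `Z` (this is the retired rev-15 item `SectorToKernelOfPentagon`),
  `P`, `R`, or all three (crux `SectorToKernel`): the negation of each weakened statement is
  equivalent to a conjunction containing `¬KontsevichZagierPeriods` (`not_withoutZ_iff`,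
  `not_withoutP_iff`, `not_withoutR_iff`, `not_withoutAll_iff`, `not_summit_of_not_without`) — no
  `_false_without_` theorem exists for any hypothesis unless Conjecture 1 is false. `P` and `R` are
  outputs of the conclusion (tree: `pentagonInKZ_of_kernel`, `kernelImpliesReduced_proof`); `Z` is
  the only independent input and it is transcendental.

Sources: M. Kontsevich, D. Zagier, *Periods* (2001), §1.2; F. Brown, Ann. of Math. 175 (2012),
Thm 1.1; H. Furusho, Ann. of Math. 174 (2011), Thm 1.2.
-/

noncomputable section

namespace Summit.KontsevichZagierPeriods.KernelModuloPeriodConjecture.Negative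

open Literature.NumberTheory.Transcendental
open Literature.NumberTheory.Transcendental.KZ
open Summit.KontsevichZagierPeriods.KontsevichZagierPeriods.Theses.FurushoPentagon

open Summit.KontsevichZagierPeriods.FurushoPentagon.StuffleInKZ (StuffleInKZ_of)
open Summit.KontsevichZagierPeriods.FurushoPentagon.HoffmanRelationInKZ (hoffmanRelationInKZ_proof)
open Summit.KontsevichZagierPeriods.FurushoPentagon.PentagonInKZNegative (not_summit_of_not_pentagonInKZ)
open Summit.KontsevichZagierPeriods.KontsevichZagierPeriods.ReducedPeriodRingNegative (withEvalHyp_iff_summit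
  not_summit_of_not_reducedPeriodRing)

/-! ## §1 Anatomy -/

/-! The conclusion `∀ c, eval c = 0 → c ∈ relations` is the summit: tree theorem
`ReducedPeriodRingNegative.withEvalHyp_iff_summit` (from `kzKernelConjecture_iff_isRational`). -/

/-- **The inner antecedents are theorems**: `SectorToKernel ↔ KernelForm` (tree theorems
`StuffleInKZ_of`, `hoffmanRelationInKZ_proof`). [folklore] -/
theorem sectorToKernel_iff_kernelForm :
    SectorToKernel ↔ (∀ c : FormalRep, eval c = 0 → c ∈ relations) :=
  ⟨fun h => h StuffleInKZ_of hoffmanRelationInKZ_proof, fun h _ _ => h⟩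

/-- **The crux is `Z → P → R → KernelForm`.** [folklore] -/
theorem iff_kernelForm :
    KernelModuloPeriodConjecture ↔
      (MzvPeriodConjecture → PentagonInKZ → ReducedPeriodRing →
        ∀ c : FormalRep, eval c = 0 → c ∈ relations) :=
  imp_congr_right fun _ => imp_congr_right fun _ => imp_congr_right fun _ =>
    sectorToKernel_iff_kernelForm

/-- **The crux is `Z → P → R → Conjecture 1`.** [folklore] -/
theorem iff_summit :
    KernelModuloPeriodConjecture ↔
      (MzvPeriodConjecture → PentagonInKZ → ReducedPeriodRing → KontsevichZagierPeriods) :=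
  iff_kernelForm.trans
    (imp_congr_right fun _ => imp_congr_right fun _ => imp_congr_right fun _ => withEvalHyp_iff_summit)

/-- **`crux ↔ (Z → summit) ∨ ¬P ∨ ¬R`.** [folklore] -/
theorem iff_or :
    KernelModuloPeriodConjecture ↔
      ((MzvPeriodConjecture → KontsevichZagierPeriods) ∨ ¬ PentagonInKZ ∨ ¬ ReducedPeriodRing) := by
  rw [iff_summit]
  constructor
  · intro h
    by_cases hP : PentagonInKZ
    · by_cases hR : ReducedPeriodRing
      · exact Or.inl fun hZ => h hZ hP hR
      · exact Or.inr (Or.inr hR)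
    · exact Or.inr (Or.inl hP)
  · rintro (h | h | h) hZ hP hR
    · exact h hZ
    · exact absurd hP h
    · exact absurd hR h

/-- **`¬crux ↔ Z ∧ P ∧ R ∧ ¬KernelForm`.** [folklore] -/
theorem not_iff :
    ¬ KernelModuloPeriodConjecture ↔
      (MzvPeriodConjecture ∧ PentagonInKZ ∧ ReducedPeriodRing ∧
        ¬ ∀ c : FormalRep, eval c = 0 → c ∈ relations) := by
  rw [iff_kernelForm]
  constructor
  · intro h
    by_contra h'
    exact h fun hZ hP hR => by_contra fun hK => h' ⟨hZ, hP, hR, hK⟩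
  · rintro ⟨hZ, hP, hR, hK⟩ h
    exact hK (h hZ hP hR)

/-- **`¬crux ↔ Z ∧ P ∧ R ∧ ¬summit`**: a refutation is a proof of the MT(ℤ) period conjecture (Hoffman
form) AND of the two mechanism cruxes AND a disproof of Conjecture 1. [folklore] -/
theorem not_iff_summit :
    ¬ KernelModuloPeriodConjecture ↔
      (MzvPeriodConjecture ∧ PentagonInKZ ∧ ReducedPeriodRing ∧ ¬ KontsevichZagierPeriods) := by
  rw [not_iff, withEvalHyp_iff_summit]

/-- **Any refutation refutes the summit.** [folklore] -/
theorem not_summit_of_not (h : ¬ KernelModuloPeriodConjecture) : ¬ KontsevichZagierPeriods :=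
  (not_iff_summit.mp h).2.2.2

/-- Any refutation proves the period conjecture for `MT(ℤ)` in Hoffman form; in particular `u ↦ ζ(u)`
is injective on Hoffman indices (no two Hoffman MZVs coincide). [folklore] -/
theorem hoffman_injective_of_not (h : ¬ KernelModuloPeriodConjecture) :
    Function.Injective (fun u : {u : List ℕ // MZV.IsHoffman u} => multipleZeta u.1) :=
  (not_iff_summit.mp h).1.injective

/-- Once the three antecedents are granted, the item IS Conjecture 1. [folklore] -/
theorem iff_summit_of_hyps (hZ : MzvPeriodConjecture) (hP : PentagonInKZ) (hR : ReducedPeriodRing) :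
    KernelModuloPeriodConjecture ↔ KontsevichZagierPeriods :=
  ⟨fun h => withEvalHyp_iff_summit.mp (sectorToKernel_iff_kernelForm.mp (h hZ hP hR)),
    fun h _ _ _ => sectorToKernel_iff_kernelForm.mpr (withEvalHyp_iff_summit.mpr h)⟩

/-- Shape of a counterexample: an element of `ker eval ∖ relations`, together with the injectivity of
`ζ` on Hoffman indices. [folklore] -/
theorem counterexample_shape (h : ¬ KernelModuloPeriodConjecture) :
    Function.Injective (fun u : {u : List ℕ // MZV.IsHoffman u} => multipleZeta u.1) ∧
      ∃ c : FormalRep, eval c = 0 ∧ c ∉ relations := by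
  refine ⟨hoffman_injective_of_not h, ?_⟩
  obtain ⟨-, -, -, hK⟩ := not_iff.mp h
  by_contra h'
  push Not at h'
  exact hK fun c hc => h' c hc

/-! ## §2 Load-bearing analysis: no `_false_without_` theorem exists -/

/-- `¬(crux without Z) ↔ P ∧ R ∧ ¬summit` — the crux without `MzvPeriodConjecture` is the retired
rev-15 item `SectorToKernelOfPentagon` (stmt-14829); refuting it needs a disproof of Conjecture 1.
[folklore] -/
theorem not_withoutZ_iff :
    ¬ (PentagonInKZ → ReducedPeriodRing → SectorToKernel) ↔
      (PentagonInKZ ∧ ReducedPeriodRing ∧ ¬ KontsevichZagierPeriods) := by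
  rw [sectorToKernel_iff_kernelForm, withEvalHyp_iff_summit]
  constructor
  · intro h
    by_contra h'
    exact h fun hP hR => by_contra fun hK => h' ⟨hP, hR, hK⟩
  · rintro ⟨hP, hR, hK⟩ h
    exact hK (h hP hR)

/-- `¬(crux without P) ↔ Z ∧ R ∧ ¬summit`. [folklore] -/
theorem not_withoutP_iff :
    ¬ (MzvPeriodConjecture → ReducedPeriodRing → SectorToKernel) ↔
      (MzvPeriodConjecture ∧ ReducedPeriodRing ∧ ¬ KontsevichZagierPeriods) := by
  rw [sectorToKernel_iff_kernelForm, withEvalHyp_iff_summit]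
  constructor
  · intro h
    by_contra h'
    exact h fun hZ hR => by_contra fun hK => h' ⟨hZ, hR, hK⟩
  · rintro ⟨hZ, hR, hK⟩ h
    exact hK (h hZ hR)

/-- `¬(crux without R) ↔ Z ∧ P ∧ ¬summit`. [folklore] -/
theorem not_withoutR_iff :
    ¬ (MzvPeriodConjecture → PentagonInKZ → SectorToKernel) ↔
      (MzvPeriodConjecture ∧ PentagonInKZ ∧ ¬ KontsevichZagierPeriods) := by
  rw [sectorToKernel_iff_kernelForm, withEvalHyp_iff_summit]
  constructor
  · intro h
    by_contra h'
    exact h fun hZ hP => by_contra fun hK => h' ⟨hZ, hP, hK⟩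
  · rintro ⟨hZ, hP, hK⟩ h
    exact hK (h hZ hP)

/-- `¬(crux without all antecedents) ↔ ¬summit` (the weakened statement is crux `SectorToKernel`,
stmt-10813). [folklore] -/
theorem not_withoutAll_iff : ¬ SectorToKernel ↔ ¬ KontsevichZagierPeriods :=
  not_congr (sectorToKernel_iff_kernelForm.trans withEvalHyp_iff_summit)

/-- So every hypothesis-drop can only be refuted by refuting Conjecture 1. [folklore] -/
theorem not_summit_of_not_without
    (h : ¬ (PentagonInKZ → ReducedPeriodRing → SectorToKernel) ∨
      ¬ (MzvPeriodConjecture → ReducedPeriodRing → SectorToKernel) ∨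
      ¬ (MzvPeriodConjecture → PentagonInKZ → SectorToKernel) ∨ ¬ SectorToKernel) :
    ¬ KontsevichZagierPeriods := by
  rcases h with h | h | h | h
  · exact (not_withoutZ_iff.mp h).2.2
  · exact (not_withoutP_iff.mp h).2.2
  · exact (not_withoutR_iff.mp h).2.2
  · exact not_withoutAll_iff.mp h

/-- The two vacuity escapes through the mechanism are themselves disproofs of the summit:
`¬P ∨ ¬R → ¬summit` (tree: `not_summit_of_not_pentagonInKZ`, `not_summit_of_not_reducedPeriodRing`). [folklore] -/
theorem not_summit_of_not_mechanism (h : ¬ PentagonInKZ ∨ ¬ ReducedPeriodRing) :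
    ¬ KontsevichZagierPeriods := by
  rcases h with h | h
  · exact not_summit_of_not_pentagonInKZ h
  · exact not_summit_of_not_reducedPeriodRing h

end Summit.KontsevichZagierPeriods.KernelModuloPeriodConjecture.Negative

end
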